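import Summits.ResolutionOfSingularities.ResolutionOfSingularities.Theorems.FrobeniusClosingSteerBinaryResidueOddSatellite
import Summits.ResolutionOfSingularities.ResolutionOfSingularities.Theorems.FrobeniusClosingSteerVisitLawDelta
import HarnessLib

/-!
# hARᵒ H2 — F5: **CLAUSE 5 (→): an odd satellite makes `x/x₁` an ODD DIVISOR at the visit after `j₂`** (three-member algebra, characteristic `2`;
# Theses-free, def-free)

OURS (campaign `res-hironaka`, rung L ★L-G4, slot W4.1 · crux `Steer` (stmt-ResolutionOfSingularities-16345) · hARᵒ slot H2, the H2ₘ decomposition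
WITHOUT divisor bookkeeping of res-type-062 g15 `H2-DESIGN.md` 7dac75913b6b98e3 §5, case (α): «j₁ an A-stage ⇒ F3 at (j₁, j₂, next)» needs the
cleaned order `d + 1` at the visit AFTER `j₂`, i.e. an odd divisor there; CLAUSE 5(→) supplies it: `x/x₁` is an odd divisor). P0 brief
`L/res-L0-w41-plan-1/P0-BRIEF-hARo.md` b66a17a38113b83f §«Remaining objects» 3; seat res-D-repro-2 g9 (P0 main hand, res-L0-w41-plan-1 RULING
221(b)/225(a)). Over F3 `BinaryResidue.binaryResidue_of_oddSatellite` (p547879: its §1 helpers and the first half of its chain are reused BY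
NAME / copy-level), the parity lemma `exists_sub_mul_sq_mem_pow_of_mul_sub_sq_mem_pow` (p546632) and the N4 core
`VisitLawDelta.clord_le_one_of_noSingularHeightOne` (p544279). Not a statement of the manuscript under review [claim: Hironaka2017, status:
under-review]; AI-produced, weaker than expert review.

THE SETTING (= F3's, minus the rationality binders and minus the cleaned order at the third member, which is the OUTPUT here): three consecutive
members `S₀ ≤ S₁ ≤ S₂ ⊆ L` of the run (the A-stage `j₁`, the visit `j₂ = B₁` after it, the visit `N = B₂` after that); window 1:
`𝔪_{S₀} = (x, u₁, u₂, u₃)`, `u_j = x·u'_j`; window 2 (SATELLITE): `𝔪_{S₁} = (x₁, v₀, v₁, v₂)` with **`v₀ = x`**, `𝔪_{S₂} = (x₁, v')`, `v_j = x₁·v'_j` —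
so `v'₀ = x/x₁`; radicands: `f₀ − G₀² ∈ 𝔪_{S₀}^d` (`d + 1 = 2e`), the squared visit laws `f₁·x^(d−1)·W² = f₀ − G²` and `f₂·x₁^(d+1)·W₁² = f₁ − G₁²`,
cleaned order `≥ d + 1` at `S₁`.

* §1 `sq_mul_eq_quotient_mul_add_sq_of_oddSatellite` — STRUCTURE at the third member: `W²·W₁²·f₂ = (x/x₁)·h″ + ρ′²` (F3's chain: structure
  `W²f₁ = x·h̃ + Δ′²` → parity `h̃′ = h̃ − x q² ∈ 𝔪_{S₁}^d` → weak transform `h̃′ = h″·x₁^d` → `W²W₁²x₁^(d+1) f₂ = x·h̃′ + ρ²`, `ρ = x q + Δ′ + W G₁`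
  → `x₁^e ∣ ρ` → cancel `x₁^(d+1)`).
* §1 `exists_sub_sq_mem_span_of_oddSatellite` — with UNIT cofactors `W, W₁` (the visit law's `W, W⁻¹ ∈ R j′`): `f₂ − g² ∈ (x/x₁)` for some `g`.
* §2 `oddDivisor_quotient_of_oddSatellite` — CLAUSE 5(→): adding N4's «no singular height-one prime» at `S₂`, `x/x₁ ∈ 𝔪_{S₂} ∖ 𝔪_{S₂}²` is
  non-zero and the clord of `f₂` along it is EXACTLY `1` (`∃ g, f₂ − g² ∈ (x/x₁)` and `∀ g, f₂ − g² ∉ ((x/x₁)²)`) — the member-level clauses of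
  `Words.IsOddDivisorAt` / `HasClordAlongAt … 1`; the run wrapper (F3ʳᵘⁿ) reads `ν_N = d + 1` off `HasReducedOrderAt`, which is F3's `hclean₂`.
[cite: Matsumura1987, Thm. 14.2, Thm. 17.10] [folklore]
-/

noncomputable section

-- `Summit.<S>.<S>.…` duplicates the summit name by design (single-problem summit).
set_option linter.dupNamespace false

open IsLocalRing MvPolynomial

namespace Summit.ResolutionOfSingularities.ResolutionOfSingularities.Theorems.SwitchingDichotomy.BinaryResidue

open Literature.AlgebraicGeometry.Resolution

variable {L : Type} [Field L]

/-! ## §1 The structure identity at the third member -/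

/-- **STRUCTURE at the visit after `j₂`: `W²·W₁²·f₂ = (x/x₁)·h″ + ρ′²`.** See the module docstring for the setting (F3's three members and two
windows, window 2 a satellite). [cite: Matsumura1987, Thm. 14.2, Thm. 17.10] [folklore] -/
theorem sq_mul_eq_quotient_mul_add_sq_of_oddSatellite (h2 : (2 : L) = 0) (S₀ S₁ S₂ : Subring L)
    [IsLocalRing S₀] [IsLocalRing S₁] [IsLocalRing S₂]
    (h01 : S₀ ≤ S₁) (h12 : S₁ ≤ S₂) (hreg₁ : IsRegularLocalRing S₁) (hreg₂ : IsRegularLocalRing S₂)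
    (hdim₁ : ringKrullDim S₁ = (4 : ℕ)) (hdim₂ : ringKrullDim S₂ = (4 : ℕ))
    -- window 1 (A-stage → B₁)
    (x : S₀) (hx0 : (x : L) ≠ 0) (u : Fin 3 → S₀) (hxu : Ideal.span (insert x (Set.range u)) = maximalIdeal S₀)
    (u' : Fin 3 → S₁) (hu : ∀ j, ((u j : S₀) : L) = (x : L) * ((u' j : S₁) : L))
    -- window 2 (B₁ → B₂), satellite: `v 0 = x`
    (x₁ : S₁) (hx₁0 : (x₁ : L) ≠ 0) (v : Fin 3 → S₁) (hv0 : ((v 0 : S₁) : L) = (x : L))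
    (hx₁v : Ideal.span (insert x₁ (Set.range v)) = maximalIdeal S₁)
    (v' : Fin 3 → S₂) (hv : ∀ j, ((v j : S₁) : L) = (x₁ : L) * ((v' j : S₂) : L))
    (hm₂ : Ideal.span (insert (⟨(x₁ : L), h12 x₁.2⟩ : S₂) (Set.range v')) = maximalIdeal S₂)
    -- radicands
    {d e : ℕ} (hde : d + 1 = 2 * e) (f₀ G₀ : S₀) (hG₀ : f₀ - G₀ ^ 2 ∈ maximalIdeal S₀ ^ d)
    (f₁ G W : S₁) (hlaw₁ : ((f₁ : S₁) : L) * (x : L) ^ (d - 1) * ((W : S₁) : L) ^ 2 = ((f₀ : S₀) : L) - ((G : S₁) : L) ^ 2)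
    (hclean₁ : ∃ γ₁ : S₁, f₁ - γ₁ ^ 2 ∈ maximalIdeal S₁ ^ (d + 1))
    (f₂ G₁ W₁ : S₂) (hlaw₂ : ((f₂ : S₂) : L) * (x₁ : L) ^ (d + 1) * ((W₁ : S₂) : L) ^ 2 = ((f₁ : S₁) : L) - ((G₁ : S₂) : L) ^ 2) :
    ∃ h'' ρ' : S₂, (⟨(W : L), h12 W.2⟩ : S₂) ^ 2 * W₁ ^ 2 * f₂ = v' 0 * h'' + ρ' ^ 2 := by
  classical
  haveI := hreg₁; haveI := hreg₂
  haveI := isDomain_of_isRegularLocalRing S₁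
  haveI := isDomain_of_isRegularLocalRing S₂
  have he : 1 ≤ e := by omega
  have hd1 : d - 1 = 2 * (e - 1) := by omega
  -- characteristic 2 in the members
  have h2S₁ : (2 : S₁) = 0 := Subtype.ext (by change S₁.subtype 2 = S₁.subtype 0; rw [map_ofNat, map_zero]; exact h2)
  have h2S₂ : (2 : S₂) = 0 := Subtype.ext (by change S₂.subtype 2 = S₂.subtype 0; rw [map_ofNat, map_zero]; exact h2)
  -- the regular systems as `Fin 4`-families
  have hsfr : ∀ (S : Subring L) [IsRegularLocalRing S], ringKrullDim S = (4 : ℕ) → (maximalIdeal S).spanFinrank = 4 := by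
    intro S _ hdim
    have h := IsRegularLocalRing.spanFinrank_maximalIdeal (R := S)
    rw [hdim] at h
    exact_mod_cast h
  set z₁ : Fin 4 → S₁ := Fin.cons x₁ v with hz₁
  have hz₁span : Ideal.span (Set.range z₁) = maximalIdeal S₁ := by rw [hz₁, Fin.range_cons, hx₁v]
  set xS₁ : S₁ := ⟨(x : L), h01 x.2⟩ with hxS₁
  have hv0' : v 0 = xS₁ := Subtype.ext hv0
  set x₁S₂ : S₂ := ⟨(x₁ : L), h12 x₁.2⟩ with hx₁S₂
  set z₂ : Fin 4 → S₂ := Fin.cons x₁S₂ v' with hz₂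
  have hz₂span : Ideal.span (Set.range z₂) = maximalIdeal S₂ := by rw [hz₂, Fin.range_cons, hm₂]
  -- `x ∈ 𝔪_{S₁} ∖ 𝔪_{S₁}²`, prime in `S₁`; `x₁ ∈ 𝔪_{S₂} ∖ 𝔪_{S₂}²`, prime in `S₂`
  have hxm₁ : xS₁ ∈ maximalIdeal S₁ := by rw [← hv0', ← hx₁v]; exact Ideal.subset_span (Set.mem_insert_of_mem _ ⟨0, rfl⟩)
  have hx2₁ : xS₁ ∉ maximalIdeal S₁ ^ 2 := by
    rw [← hv0']
    exact not_mem_sq_of_span_eq (hsfr S₁ hdim₁) z₁ hz₁span (Fin.succ 0)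
  have hxS₁0 : xS₁ ≠ 0 := fun h => hx0 (congrArg Subtype.val h)
  have hxprime : Prime xS₁ :=
    (Ideal.span_singleton_prime hxS₁0).mp (SigmaTopLegality.isPrime_span_singleton_of_not_mem_sq S₁ hxm₁ hx2₁)
  have hx₁m₂ : x₁S₂ ∈ maximalIdeal S₂ := by rw [← hm₂]; exact Ideal.subset_span (Set.mem_insert _ _)
  have hx₁2₂ : x₁S₂ ∉ maximalIdeal S₂ ^ 2 := not_mem_sq_of_span_eq (hsfr S₂ hdim₂) z₂ hz₂span 0
  have hx₁S₂0 : x₁S₂ ≠ 0 := fun h => hx₁0 (congrArg Subtype.val h)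
  have hx₁prime : Prime x₁S₂ :=
    (Ideal.span_singleton_prime hx₁S₂0).mp (SigmaTopLegality.isPrime_span_singleton_of_not_mem_sq S₂ hx₁m₂ hx₁2₂)
  -- (a) STRUCTURE: the weak transform `h̃ = (f₀ − G₀²)/x^d ∈ S₁` and `W²·f₁ = x·h̃ + Δ′²`
  obtain ⟨ht, hht⟩ := exists_mul_pow_eq_of_mem_pow h01 x u hxu u' hu hG₀
  set G₀S₁ : S₁ := ⟨(G₀ : L), h01 G₀.2⟩ with hG₀S₁
  have hxL : ((xS₁ : S₁) : L) = (x : L) := rfl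
  have hGL : ((G₀S₁ : S₁) : L) = (G₀ : L) := rfl
  have hsq : (G₀S₁ - G) ^ 2 = xS₁ ^ (d - 1) * (W ^ 2 * f₁ - xS₁ * ht) := by
    apply Subtype.ext
    push_cast
    rw [hxL, hGL]
    have e1 : (x : L) ^ d = (x : L) ^ (d - 1) * (x : L) := by rw [← pow_succ, show d - 1 + 1 = d by omega]
    have hhtd : ((ht : S₁) : L) * ((x : L) ^ (d - 1) * (x : L)) = ((f₀ : S₀) : L) - ((G₀ : S₀) : L) ^ 2 := by
      rw [← e1, hht]; push_cast; ring
    linear_combination (-1 : L) * hlaw₁ + (1 : L) * hhtd +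
      (((G : S₁) : L) * (((G : S₁) : L) - ((G₀ : S₀) : L))) * h2
  have hsq' : (G₀S₁ - G) ^ 2 = xS₁ ^ (2 * (e - 1)) * (W ^ 2 * f₁ - xS₁ * ht) := by rw [← hd1]; exact hsq
  obtain ⟨Δ, hΔ⟩ := pow_dvd_of_pow_two_mul_dvd_sq hxprime (e - 1) (a := G₀S₁ - G) ⟨_, hsq'⟩
  have hstruct : W ^ 2 * f₁ = xS₁ * ht + Δ ^ 2 := by
    have hne : xS₁ ^ (2 * (e - 1)) ≠ 0 := pow_ne_zero _ hxS₁0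
    have h3 : xS₁ ^ (2 * (e - 1)) * (W ^ 2 * f₁ - xS₁ * ht) = xS₁ ^ (2 * (e - 1)) * Δ ^ 2 := by
      rw [← hsq', hΔ]; ring
    have h4 := mul_left_cancel₀ hne h3
    linear_combination h4
  -- (b) PARITY: `x·h̃ − (W γ₁ + Δ)² ∈ 𝔪^(d+1)` ⇒ `h̃′ := h̃ − x q² ∈ 𝔪^d`
  obtain ⟨γ₁, hγ₁⟩ := hclean₁
  have hrel : xS₁ * ht - (W * γ₁ + Δ) ^ 2 ∈ maximalIdeal S₁ ^ (2 * e) := by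
    have : xS₁ * ht - (W * γ₁ + Δ) ^ 2 = W ^ 2 * (f₁ - γ₁ ^ 2) := by
      linear_combination (-1 : S₁) * hstruct + (-(W * γ₁ * Δ) - Δ ^ 2) * h2S₁
    rw [this, ← hde]
    exact Ideal.mul_mem_left _ _ hγ₁
  obtain ⟨q, hq⟩ := exists_sub_mul_sq_mem_pow_of_mul_sub_sq_mem_pow h2S₁ hxm₁ hx2₁ he hrel
  rw [show 2 * e - 1 = d by omega] at hq
  set ht' : S₁ := ht - xS₁ * q ^ 2 with hht'
  -- (d) F2 at window 2: `h̃′ ∈ (x) + (v₁, v₂)^d + 𝔪^(d+1)`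
  obtain ⟨ht'', hht''⟩ := exists_mul_pow_eq_of_mem_pow h12 x₁ v hx₁v v' hv hq
  -- the member at `S₂`: `W² W₁² x₁^(d+1) f₂ = x h̃′ + ρ²`, `ρ = x q + Δ + W G₁`
  have h02 : S₀ ≤ S₂ := h01.trans h12
  set WS₂ : S₂ := ⟨(W : L), h12 W.2⟩ with hWS₂
  have hWL : ((WS₂ : S₂) : L) = (W : L) := rfl
  have hx₁L : ((x₁S₂ : S₂) : L) = (x₁ : L) := rfl
  set ρ : S₂ := ⟨(x : L) * ((q : S₁) : L) + ((Δ : S₁) : L) + ((W : S₁) : L) * ((G₁ : S₂) : L),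
    S₂.add_mem (S₂.add_mem (S₂.mul_mem (h02 x.2) (h12 q.2)) (h12 Δ.2)) (S₂.mul_mem (h12 W.2) G₁.2)⟩ with hρ
  have hρL : ((ρ : S₂) : L) = (x : L) * ((q : S₁) : L) + ((Δ : S₁) : L) + ((W : S₁) : L) * ((G₁ : S₂) : L) := rfl
  have hht'L : ((ht' : S₁) : L) = ((ht : S₁) : L) - (x : L) * ((q : S₁) : L) ^ 2 := by
    rw [hht']; push_cast; rw [hxL]
  have hmem₂ : WS₂ ^ 2 * W₁ ^ 2 * x₁S₂ ^ (d + 1) * f₂ = v' 0 * x₁S₂ * (ht'' * x₁S₂ ^ d) + ρ ^ 2 := by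
    apply Subtype.ext
    push_cast
    rw [hWL, hx₁L, hρL, hht'', hht'L]
    have hv0L : ((v' 0 : S₂) : L) * (x₁ : L) = (x : L) := by rw [mul_comm, ← hv 0, hv0]
    have hstructL : ((W : S₁) : L) ^ 2 * ((f₁ : S₁) : L) = (x : L) * ((ht : S₁) : L) + ((Δ : S₁) : L) ^ 2 := by
      have := congrArg Subtype.val hstruct
      push_cast at this
      rw [hxL] at this
      exact this
    linear_combination (((W : S₁) : L) ^ 2) * hlaw₂ + hstructL +
      ((x : L) * ((q : S₁) : L) ^ 2 - ((ht : S₁) : L)) * hv0L -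
      (((W : S₁) : L) ^ 2 * ((G₁ : S₂) : L) ^ 2 + (x : L) * ((q : S₁) : L) * ((Δ : S₁) : L) +
        (x : L) * ((q : S₁) : L) * ((W : S₁) : L) * ((G₁ : S₂) : L) + ((Δ : S₁) : L) * ((W : S₁) : L) * ((G₁ : S₂) : L)) * h2
  -- `ρ = ρ′ · x₁^e`
  obtain ⟨ρ', hρ'⟩ := pow_dvd_of_pow_two_mul_dvd_sq hx₁prime e (a := ρ) (by
    refine ⟨WS₂ ^ 2 * W₁ ^ 2 * f₂ - v' 0 * ht'', ?_⟩
    rw [← hde]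
    linear_combination (-1 : S₂) * hmem₂)
  -- cancel `x₁^(d+1)`: `W² W₁² f₂ = (x/x₁)·h″ + ρ′²`
  refine ⟨ht'', ρ', ?_⟩
  have hne : x₁S₂ ^ (d + 1) ≠ 0 := pow_ne_zero _ hx₁S₂0
  have eρ : ρ ^ 2 = x₁S₂ ^ (d + 1) * ρ' ^ 2 := by rw [hρ', hde]; ring
  have key : x₁S₂ ^ (d + 1) * (WS₂ ^ 2 * W₁ ^ 2 * f₂) = x₁S₂ ^ (d + 1) * (v' 0 * ht'' + ρ' ^ 2) := by
    linear_combination hmem₂ + eρ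
  exact mul_left_cancel₀ hne key

/-- **`x/x₁` divides a cleaning of `f₂`** when the cofactors `W, W₁` of the two visit laws are UNITS (the run's visit law provides
`W, W⁻¹ ∈ R j′`): `f₂ − g² ∈ (x/x₁)` for `g := ρ′·(W W₁)⁻¹`. [folklore] -/
theorem exists_sub_sq_mem_span_of_oddSatellite (h2 : (2 : L) = 0) (S₀ S₁ S₂ : Subring L)
    [IsLocalRing S₀] [IsLocalRing S₁] [IsLocalRing S₂]
    (h01 : S₀ ≤ S₁) (h12 : S₁ ≤ S₂) (hreg₁ : IsRegularLocalRing S₁) (hreg₂ : IsRegularLocalRing S₂)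
    (hdim₁ : ringKrullDim S₁ = (4 : ℕ)) (hdim₂ : ringKrullDim S₂ = (4 : ℕ))
    (x : S₀) (hx0 : (x : L) ≠ 0) (u : Fin 3 → S₀) (hxu : Ideal.span (insert x (Set.range u)) = maximalIdeal S₀)
    (u' : Fin 3 → S₁) (hu : ∀ j, ((u j : S₀) : L) = (x : L) * ((u' j : S₁) : L))
    (x₁ : S₁) (hx₁0 : (x₁ : L) ≠ 0) (v : Fin 3 → S₁) (hv0 : ((v 0 : S₁) : L) = (x : L))
    (hx₁v : Ideal.span (insert x₁ (Set.range v)) = maximalIdeal S₁)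
    (v' : Fin 3 → S₂) (hv : ∀ j, ((v j : S₁) : L) = (x₁ : L) * ((v' j : S₂) : L))
    (hm₂ : Ideal.span (insert (⟨(x₁ : L), h12 x₁.2⟩ : S₂) (Set.range v')) = maximalIdeal S₂)
    {d e : ℕ} (hde : d + 1 = 2 * e) (f₀ G₀ : S₀) (hG₀ : f₀ - G₀ ^ 2 ∈ maximalIdeal S₀ ^ d)
    (f₁ G W : S₁) (hlaw₁ : ((f₁ : S₁) : L) * (x : L) ^ (d - 1) * ((W : S₁) : L) ^ 2 = ((f₀ : S₀) : L) - ((G : S₁) : L) ^ 2)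
    (hclean₁ : ∃ γ₁ : S₁, f₁ - γ₁ ^ 2 ∈ maximalIdeal S₁ ^ (d + 1))
    (f₂ G₁ W₁ : S₂) (hlaw₂ : ((f₂ : S₂) : L) * (x₁ : L) ^ (d + 1) * ((W₁ : S₂) : L) ^ 2 = ((f₁ : S₁) : L) - ((G₁ : S₂) : L) ^ 2)
    (hW : IsUnit W) (hW₁ : IsUnit W₁) :
    ∃ g : S₂, f₂ - g ^ 2 ∈ Ideal.span {v' 0} := by
  obtain ⟨h'', ρ', hstr⟩ := sq_mul_eq_quotient_mul_add_sq_of_oddSatellite h2 S₀ S₁ S₂ h01 h12 hreg₁ hreg₂ hdim₁ hdim₂ x hx0 u hxu u' hu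
    x₁ hx₁0 v hv0 hx₁v v' hv hm₂ hde f₀ G₀ hG₀ f₁ G W hlaw₁ hclean₁ f₂ G₁ W₁ hlaw₂
  -- the unit `W·W₁` in `S₂`
  have hWS₂ : IsUnit (⟨(W : L), h12 W.2⟩ : S₂) := by
    obtain ⟨Winv, hWinv⟩ := hW.exists_left_inv
    refine IsUnit.of_mul_eq_one ⟨(Winv : L), h12 Winv.2⟩ (Subtype.ext ?_)
    have := congrArg (fun z : S₁ => (z : L)) hWinv
    simpa [mul_comm] using this
  -- `(W W₁)⁻¹ =: cW`; take `g := ρ′ · cW`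
  obtain ⟨cW, hcW⟩ := (hWS₂.mul hW₁).exists_left_inv
  refine ⟨ρ' * cW, ?_⟩
  rw [Ideal.mem_span_singleton]
  refine ⟨cW ^ 2 * h'', ?_⟩
  have hcc : cW ^ 2 * ((⟨(W : L), h12 W.2⟩ : S₂) ^ 2 * W₁ ^ 2) = 1 := by
    have : cW ^ 2 * ((⟨(W : L), h12 W.2⟩ : S₂) ^ 2 * W₁ ^ 2) = (cW * ((⟨(W : L), h12 W.2⟩ : S₂) * W₁)) ^ 2 := by ring
    rw [this, hcW, one_pow]
  linear_combination (cW ^ 2) * hstr + (-(f₂ : S₂)) * hcc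

/-! ## §2 CLAUSE 5 (→): `x/x₁` is an odd divisor at the visit after `j₂` -/

/-- **CLAUSE 5 (→).** In the setting of `sq_mul_eq_quotient_mul_add_sq_of_oddSatellite` with unit cofactors, if moreover NO height-one prime of
`S₂` is a singular prime of `T² = f₂` (N4 at the late point step), then `x/x₁ = v'₀` is a non-zero REGULAR PARAMETER of `S₂` and the clord of
`f₂` along it is EXACTLY `1`: `x/x₁` is an ODD DIVISOR at the visit after `j₂` (member-level clauses of `Words.IsOddDivisorAt` /
`Words.HasClordAlongAt … 1`). [cite: Matsumura1987, Thm. 14.2] [folklore] -/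
theorem oddDivisor_quotient_of_oddSatellite (h2 : (2 : L) = 0) (S₀ S₁ S₂ : Subring L)
    [IsLocalRing S₀] [IsLocalRing S₁] [IsLocalRing S₂]
    (h01 : S₀ ≤ S₁) (h12 : S₁ ≤ S₂) (hreg₁ : IsRegularLocalRing S₁) (hreg₂ : IsRegularLocalRing S₂)
    (hdim₁ : ringKrullDim S₁ = (4 : ℕ)) (hdim₂ : ringKrullDim S₂ = (4 : ℕ))
    (x : S₀) (hx0 : (x : L) ≠ 0) (u : Fin 3 → S₀) (hxu : Ideal.span (insert x (Set.range u)) = maximalIdeal S₀)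
    (u' : Fin 3 → S₁) (hu : ∀ j, ((u j : S₀) : L) = (x : L) * ((u' j : S₁) : L))
    (x₁ : S₁) (hx₁0 : (x₁ : L) ≠ 0) (v : Fin 3 → S₁) (hv0 : ((v 0 : S₁) : L) = (x : L))
    (hx₁v : Ideal.span (insert x₁ (Set.range v)) = maximalIdeal S₁)
    (v' : Fin 3 → S₂) (hv : ∀ j, ((v j : S₁) : L) = (x₁ : L) * ((v' j : S₂) : L))
    (hm₂ : Ideal.span (insert (⟨(x₁ : L), h12 x₁.2⟩ : S₂) (Set.range v')) = maximalIdeal S₂)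
    {d e : ℕ} (hde : d + 1 = 2 * e) (f₀ G₀ : S₀) (hG₀ : f₀ - G₀ ^ 2 ∈ maximalIdeal S₀ ^ d)
    (f₁ G W : S₁) (hlaw₁ : ((f₁ : S₁) : L) * (x : L) ^ (d - 1) * ((W : S₁) : L) ^ 2 = ((f₀ : S₀) : L) - ((G : S₁) : L) ^ 2)
    (hclean₁ : ∃ γ₁ : S₁, f₁ - γ₁ ^ 2 ∈ maximalIdeal S₁ ^ (d + 1))
    (f₂ G₁ W₁ : S₂) (hlaw₂ : ((f₂ : S₂) : L) * (x₁ : L) ^ (d + 1) * ((W₁ : S₂) : L) ^ 2 = ((f₁ : S₁) : L) - ((G₁ : S₂) : L) ^ 2)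
    (hW : IsUnit W) (hW₁ : IsUnit W₁) [CharP L 2]
    (h1 : ∀ (Q : Ideal S₂) [Q.IsPrime], Q.height = 1 → ¬ SigmaTopLegality.IsSingPrime S₂ 2 f₂ Q) :
    v' 0 ∈ maximalIdeal S₂ ∧ v' 0 ∉ maximalIdeal S₂ ^ 2 ∧ ((v' 0 : S₂) : L) ≠ 0 ∧
      (∃ g : S₂, f₂ - g ^ 2 ∈ Ideal.span {v' 0 ^ 1}) ∧ (∀ g : S₂, f₂ - g ^ 2 ∉ Ideal.span {v' 0 ^ (1 + 1)}) := by
  classical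
  haveI := hreg₂
  -- `v'0 ∈ 𝔪_{S₂} ∖ 𝔪_{S₂}²`, non-zero
  have hsfr₂ : (maximalIdeal S₂).spanFinrank = 4 := by
    have h := IsRegularLocalRing.spanFinrank_maximalIdeal (R := S₂)
    rw [hdim₂] at h
    exact_mod_cast h
  set x₁S₂ : S₂ := ⟨(x₁ : L), h12 x₁.2⟩ with hx₁S₂
  set z₂ : Fin 4 → S₂ := Fin.cons x₁S₂ v' with hz₂
  have hz₂span : Ideal.span (Set.range z₂) = maximalIdeal S₂ := by rw [hz₂, Fin.range_cons, hm₂]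
  have hvm : v' 0 ∈ maximalIdeal S₂ := by rw [← hm₂]; exact Ideal.subset_span (Set.mem_insert_of_mem _ ⟨0, rfl⟩)
  have hv2 : v' 0 ∉ maximalIdeal S₂ ^ 2 := by
    have := not_mem_sq_of_span_eq hsfr₂ z₂ hz₂span (Fin.succ 0)
    simpa [hz₂] using this
  have hvL0 : ((v' 0 : S₂) : L) ≠ 0 := by
    intro h0
    apply hx0
    rw [← hv0, hv 0, h0, mul_zero]
  have hv0ne : v' 0 ≠ 0 := fun h => hvL0 (congrArg Subtype.val h)
  obtain ⟨g, hg⟩ := exists_sub_sq_mem_span_of_oddSatellite h2 S₀ S₁ S₂ h01 h12 hreg₁ hreg₂ hdim₁ hdim₂ x hx0 u hxu u' hu x₁ hx₁0 v hv0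
    hx₁v v' hv hm₂ hde f₀ G₀ hG₀ f₁ G W hlaw₁ hclean₁ f₂ G₁ W₁ hlaw₂ hW hW₁
  refine ⟨hvm, hv2, hvL0, ⟨g, by rwa [pow_one]⟩, fun g' hg' => ?_⟩
  have hle := VisitLawDelta.clord_le_one_of_noSingularHeightOne S₂ f₂ hvm hv2 hv0ne h1 ⟨g', hg'⟩
  omega

end Summit.ResolutionOfSingularities.ResolutionOfSingularities.Theorems.SwitchingDichotomy.BinaryResidue

end
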